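import Literature.Analysis.SegalBargmann.SchwartzHeisenbergModel
import Literature.Analysis.SegalBargmann.SchrodingerCompactRigidity
import HarnessLib

/-!
# The Schrödinger representation of the real Heisenberg group on the genuine `L²(ℝ^σ)`: unitarity, central character, irreducibility, vacuum coefficient (Folland 1989 §1.3, §1.5)

Topic `Analysis/SegalBargmann`; namespace `Literature.Analysis.SegalBargmann`.

The tree holds Folland's symmetric operators `rho p q = ρ(p,q)` on `L²(ℝ^σ)` (`SchrodingerWeyl`, with the Weyl
law `rho_mul` and Schur's lemma `rho_schur` / `rho_commutant_is_scalar`, `FockHeisenbergSchur`) and the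
representation `schwartzSchrodinger σ` of the polarised real Heisenberg group `HeisR σ = Heisenberg (polar (dotPairing σ))`
on SCHWARTZ space (`SchwartzHeisenbergModel`).  This file packages the `L²` operators as an honest representation of
`HeisR σ` on the Hilbert space `L²(ℝ^σ)` — the object "irreducible unitary representation `ρ_ψ` of the Heisenberg
group with central character `ψ`" of the literature ([GelbartRogawski1991, §3.1 p. 454 L19–21], there adelic) at a
real place — and proves its defining properties:

* §1 **`rhoRep σ : Representation ℂ (HeisR σ) L²(ℝ^σ)`**, `ρ((p,q),t) = 𝐞(t − ½ p·q) • ρ(p,q)` (`rhoRep_apply`),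
  `rho_zero_zero` (`ρ(0,0) = 1`); the junction with the Schwartz model `toL2_schwartzSchrodinger`
  (`toL2 ∘ schwartzSchrodinger σ h = rhoRep σ h ∘ toL2`);
* §2 unitarity `norm_rhoRep_apply`, the central character `rhoRep_center` (`ρ(0,t) = 𝐞(t)`), and
  `rhoRep_mk_zero_apply` (`ρ((p,q),0) = 𝐞(−½ p·q) • ρ(p,q)`);
* §3 **irreducibility** `rhoRep_irreducible`: the closed `ρ(H)`-invariant subspaces of `L²(ℝ^σ)` are `⊥` and `⊤` —
  from Schur's lemma `rho_commutant_is_scalar` applied to the orthogonal projection;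
* §4 the **vacuum coefficient** `inner_rho_vacL2_vacL2` / `inner_rhoRep_vacL2_vacL2`:
  `⟪ρ(p,q) k₀, k₀⟫ = e^{-(π/2)(|p|² + |q|²)}` for the Gaussian `k₀ = vacL2` (Folland (1.72) read through the
  reproducing kernel).

Everything is PROVED (Mathlib + tree); no cited statement is used as a hypothesis.

## References

* [Folland1989] G. B. Folland, *Harmonic Analysis in Phase Space*, Princeton University Press, 1989, §1.3
  (1.25), Prop. (1.43), §1.5 Theorem (1.50), (1.72) (doi:10.1515/9781400882427).
* [GelbartRogawski1991] S. Gelbart, J. Rogawski, Invent. Math. 105 (1991), §3.1 p. 454 L19–21.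
-/

noncomputable section

open MeasureTheory Complex
open scoped InnerProductSpace ComplexConjugate Real FourierTransform

namespace Literature.Analysis.SegalBargmann

open Literature.RepresentationTheory.HeisenbergGroup

set_option autoImplicit false

variable (σ : Type*) [Fintype σ]

local notation "L2R" σ => Lp ℂ 2 (volume : Measure (σ → ℝ))
local notation "SR" σ => SchwartzMap (σ → ℝ) ℂ

/-! ## 1. The representation -/

variable {σ} in
omit [Fintype σ] in
/-- `phasePt 0 0 = 0`. [cite: Folland1989, §1.3 (1.25)] -/
@[simp] theorem phasePt_zero_zero : phasePt (0 : σ → ℝ) (0 : σ → ℝ) = 0 := by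
  funext k; simp [phasePt]

variable {σ} in
/-- `rhoPhase z 0 = 1`. [cite: Folland1989, (1.71)] -/
@[simp] theorem rhoPhase_zero_right (z : σ → ℂ) : rhoPhase z 0 = 1 := by
  simp [rhoPhase]

/-- The Schrödinger operator of `h = ((p,q),t)` on `L²(ℝ^σ)`: `𝐞(t − ½ p·q) • ρ(p,q)`, a continuous linear
operator (the `L²` version of `schwartzSchrodingerCLM`). [cite: Folland1989, §1.3 (1.25)] -/
def rhoRepCLM (h : HeisR σ) : (L2R σ) →L[ℂ] L2R σ :=
  (((𝐞 (h.t - 2⁻¹ * (h.v.1 ⬝ᵥ h.v.2)) : Circle) : ℂ)) •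
    ((rho h.v.1 h.v.2).toContinuousLinearEquiv : (L2R σ) →L[ℂ] L2R σ)

/-- Unfolding of `rhoRepCLM`. [cite: Folland1989, §1.3 (1.25)] -/
theorem rhoRepCLM_apply (h : HeisR σ) (f : L2R σ) :
    rhoRepCLM σ h f = (((𝐞 (h.t - 2⁻¹ * (h.v.1 ⬝ᵥ h.v.2)) : Circle) : ℂ)) • rho h.v.1 h.v.2 f := rfl

/-- The phase bookkeeping of the group law in polarised coordinates:
`𝐞(t − ½p·q) 𝐞(t' − ½p'·q') e^{iπ(p·q' − q·p')} = 𝐞(t + t' + p·q' − ½(p+p')·(q+q'))`.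
[cite: Folland1989, §1.3 (1.22)–(1.25)] -/
theorem phase_mul (p q p' q' : σ → ℝ) (t t' : ℝ) :
    ((𝐞 (t - 2⁻¹ * (p ⬝ᵥ q)) : Circle) : ℂ) * ((𝐞 (t' - 2⁻¹ * (p' ⬝ᵥ q')) : Circle) : ℂ) *
        cexp (((π * ∑ k, (p k * q' k - q k * p' k) : ℝ) : ℂ) * I) =
      ((𝐞 (t + t' + p ⬝ᵥ q' - 2⁻¹ * ((p + p') ⬝ᵥ (q + q'))) : Circle) : ℂ) := by
  have hsum : ∑ k, (p k * q' k - q k * p' k) = p ⬝ᵥ q' - p' ⬝ᵥ q := by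
    rw [Finset.sum_sub_distrib]
    simp only [dotProduct, mul_comm (q _) (p' _)]
  rw [hsum, fourierChar_coe, fourierChar_coe, fourierChar_coe, ← Complex.exp_add, ← Complex.exp_add]
  congr 1
  simp only [add_dotProduct, dotProduct_add, dotProduct_comm p' q]
  push_cast
  ring

variable [DecidableEq σ]

variable {σ} in
/-- `ρ(0,0) = 1` on `L²(ℝ^σ)`. [cite: Folland1989, §1.3 (1.25)] -/
@[simp] theorem rho_zero_zero (f : L2R σ) : rho (0 : σ → ℝ) 0 f = f := by
  refine ext_of_bargmannFun fun z => ?_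
  rw [bargmannFun_rho, phasePt_zero_zero, rhoPhase_zero_right, one_mul, add_zero]

variable {σ} in
/-- `ρ(-p,-q) ρ(p,q) = 1`. [cite: Folland1989, §1.3 (1.25)–(1.26)] -/
theorem rho_neg_rho (p q : σ → ℝ) (f : L2R σ) : rho (-p) (-q) (rho p q f) = f := by
  rw [rho_mul]
  have h0 : ∑ k, ((-p) k * q k - (-q) k * p k) = 0 := by
    simp [mul_comm]
  rw [h0]
  simp

/-- **The Schrödinger representation of the real Heisenberg group on `L²(ℝ^σ)`** (central character
`ψ_∞ = 𝐞 = e^{2πi·}`): `ρ((p,q),t) = 𝐞(t − ½ p·q) ρ(p,q)`.  [cite: Folland1989, §1.3 (1.25); GelbartRogawski1991, §3.1 p. 454 L19–21] -/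
def rhoRep : Representation ℂ (HeisR σ) (L2R σ) where
  toFun h := (rhoRepCLM σ h : (L2R σ) →ₗ[ℂ] L2R σ)
  map_one' := by
    apply LinearMap.ext
    intro f
    show rhoRepCLM σ 1 f = f
    rw [rhoRepCLM_apply]
    show (((𝐞 ((0 : ℝ) - 2⁻¹ * ((0 : σ → ℝ) ⬝ᵥ (0 : σ → ℝ)))) : Circle) : ℂ) • rho (0 : σ → ℝ) 0 f = f
    simp
  map_mul' a b := by
    apply LinearMap.ext
    intro f
    show rhoRepCLM σ (a * b) f = rhoRepCLM σ a (rhoRepCLM σ b f)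
    rw [rhoRepCLM_apply, rhoRepCLM_apply, rhoRepCLM_apply, LinearIsometryEquiv.map_smul, rho_mul, smul_smul,
      smul_smul, phase_mul]
    simp only [Heisenberg.mul_t, Heisenberg.mul_v, Prod.fst_add, Prod.snd_add, polar_apply, dotPairing_apply]

/-- Unfolding: `ρ(h) f = 𝐞(t − ½ p·q) • ρ(p,q) f` for `h = ((p,q),t)`. [cite: Folland1989, §1.3 (1.25)] -/
theorem rhoRep_apply (h : HeisR σ) (f : L2R σ) :
    rhoRep σ h f = (((𝐞 (h.t - 2⁻¹ * (h.v.1 ⬝ᵥ h.v.2)) : Circle) : ℂ)) • rho h.v.1 h.v.2 f := rfl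

/-- Unfolding on an anonymous constructor. [cite: Folland1989, §1.3 (1.25)] -/
theorem rhoRep_mk_apply (p q : σ → ℝ) (t : ℝ) (f : L2R σ) :
    rhoRep σ ⟨(p, q), t⟩ f = (((𝐞 (t - 2⁻¹ * (p ⬝ᵥ q))) : Circle) : ℂ) • rho p q f := rfl

/-- `ρ(p,q) = ρ((p,q), ½ p·q)`. [cite: Folland1989, §1.3 (1.25)] -/
theorem rho_eq_rhoRep (p q : σ → ℝ) (f : L2R σ) : rho p q f = rhoRep σ ⟨(p, q), 2⁻¹ * (p ⬝ᵥ q)⟩ f := by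
  rw [rhoRep_mk_apply, sub_self, AddChar.map_zero_eq_one, Circle.coe_one, one_smul]

/-- **Junction with the Schwartz model**: `toL2 (schwartzSchrodinger σ h f) = rhoRep σ h (toL2 f)` — the `L²`
representation extends the representation on `𝓢(ℝ^σ)`. [cite: Folland1989, §1.3 (1.25)] -/
theorem toL2_schwartzSchrodinger (h : HeisR σ) (f : SR σ) :
    toL2 (schwartzSchrodinger σ h f) = rhoRep σ h (toL2 f) := by
  rw [schwartzSchrodinger_eq_smul_rhoS, map_smul, toL2_rhoS, rhoRep_apply]

/-! ## 2. Unitarity, central character, Weyl relations -/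

/-- **Unitarity**: every `ρ(h)` is an isometry of `L²(ℝ^σ)`. [cite: Folland1989, §1.3 (1.25)] -/
theorem norm_rhoRep_apply (h : HeisR σ) (f : L2R σ) : ‖rhoRep σ h f‖ = ‖f‖ := by
  rw [rhoRep_apply, norm_smul, Circle.norm_coe, one_mul, LinearIsometryEquiv.norm_map]

/-- `ρ(h)` preserves inner products. [cite: Folland1989, §1.3 (1.25)] -/
theorem inner_rhoRep_apply_rhoRep_apply (h : HeisR σ) (f g : L2R σ) :
    ⟪rhoRep σ h f, rhoRep σ h g⟫_ℂ = ⟪f, g⟫_ℂ :=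
  LinearIsometry.inner_map_map (⟨rhoRep σ h, norm_rhoRep_apply σ h⟩ : (L2R σ) →ₗᵢ[ℂ] L2R σ) f g

/-- **Central character**: `ρ(0, t) = 𝐞(t)`. [cite: Folland1989, §1.3 (1.25); GelbartRogawski1991, §3.1 p. 454 L20–21] -/
theorem rhoRep_center (t : ℝ) (f : L2R σ) :
    rhoRep σ (Heisenberg.ofCenter (polar (dotPairing σ)) (Multiplicative.ofAdd t)) f =
      ((𝐞 t : Circle) : ℂ) • f := by
  show rhoRep σ ⟨((0 : σ → ℝ), (0 : σ → ℝ)), t⟩ f = _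
  rw [rhoRep_mk_apply]
  simp

/-- The operators `ρ((p,q),0)` and the symmetric `ρ(p,q)`: `ρ((p,q),0) = 𝐞(−½ p·q) • ρ(p,q)`.
[cite: Folland1989, §1.3 (1.25)] -/
theorem rhoRep_mk_zero_apply (w : (σ → ℝ) × (σ → ℝ)) (f : L2R σ) :
    rhoRep σ ⟨w, 0⟩ f = (((𝐞 (-(2⁻¹ * (w.1 ⬝ᵥ w.2)))) : Circle) : ℂ) • rho w.1 w.2 f := by
  rw [rhoRep_apply, zero_sub]

/-! ## 3. Irreducibility -/

/-- **Irreducibility of the Schrödinger representation on `L²(ℝ^σ)`**: a closed subspace invariant under all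
`ρ(h)` is `⊥` or `⊤`.  Proof: the orthogonal projection onto it commutes with every `ρ(p,q)` (invariance of the
subspace and, by unitarity and `ρ(p,q)⁻¹ = ρ(-p,-q)`, of its orthogonal complement), hence is a scalar by Schur's
lemma `rho_commutant_is_scalar`, hence `0` or `1`. [cite: Folland1989, §1.5 Prop. (1.43)] -/
theorem rhoRep_irreducible (K : Submodule ℂ (L2R σ)) (hKc : IsClosed (K : Set (L2R σ)))
    (hK : ∀ (h : HeisR σ), ∀ f ∈ K, rhoRep σ h f ∈ K) : K = ⊥ ∨ K = ⊤ := by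
  haveI : CompleteSpace K := hKc.completeSpace_coe
  have hKρ : ∀ (p q : σ → ℝ), ∀ f ∈ K, rho p q f ∈ K := fun p q f hf => by
    rw [rho_eq_rhoRep]; exact hK _ f hf
  -- `ρ(p,q)` preserves `Kᗮ`
  have hKo : ∀ (p q : σ → ℝ), ∀ g ∈ Kᗮ, rho p q g ∈ Kᗮ := by
    intro p q g hg
    rw [Submodule.mem_orthogonal] at hg ⊢
    intro m hm
    have e : rho p q (rho (-p) (-q) m) = m := by simpa using rho_neg_rho (-p) (-q) m
    calc ⟪m, rho p q g⟫_ℂ = ⟪rho p q (rho (-p) (-q) m), rho p q g⟫_ℂ := by rw [e]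
      _ = ⟪rho (-p) (-q) m, g⟫_ℂ := (rho p q).inner_map_map _ _
      _ = 0 := hg _ (hKρ _ _ m hm)
  -- the orthogonal projection onto `K` commutes with every `ρ(p,q)`
  have hP : ∀ (p q : σ → ℝ) (f : L2R σ), K.starProjection (rho p q f) = rho p q (K.starProjection f) := by
    intro p q f
    have h1 : rho p q (K.starProjection f) ∈ K := hKρ p q _ (K.starProjection_apply_mem f)
    have h2 : rho p q (f - K.starProjection f) ∈ Kᗮ := hKo p q _ (K.sub_starProjection_mem_orthogonal f)
    exact Submodule.eq_starProjection_of_mem_orthogonal' h1 h2 (by rw [← map_add, add_sub_cancel])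
  obtain ⟨a, ha⟩ := rho_commutant_is_scalar K.starProjection hP
  rcases eq_or_ne K ⊥ with hbot | hne
  · exact Or.inl hbot
  · right
    obtain ⟨k, hkK, hk0⟩ := Submodule.exists_mem_ne_zero_of_ne_bot hne
    have ha1 : a = 1 := by
      have e1 : K.starProjection k = k := Submodule.starProjection_eq_self_iff.2 hkK
      rw [ha] at e1
      have e2 : (a - 1) • k = 0 := by rw [sub_smul, one_smul, e1, sub_self]
      rcases smul_eq_zero.1 e2 with h0 | h0
      · exact sub_eq_zero.1 h0
      · exact absurd h0 hk0
    refine Submodule.eq_top_iff'.2 fun f => ?_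
    rw [← Submodule.starProjection_eq_self_iff (K := K), ha, ha1, one_smul]

/-! ## 4. The vacuum coefficient -/

omit [DecidableEq σ] in
/-- **The vacuum coefficient of the Schrödinger representation** (Folland (1.72) `β(w) E₀ = e^{-(π/2)|w|²} E_{-w}`
read through the reproducing kernel): `⟪k₀, ρ(p,q) k₀⟫ = e^{-(π/2) Σ_k (p_k² + q_k²)}` for the Gaussian `k₀ = vacL2`.
[cite: Folland1989, (1.72)] -/
theorem inner_vacL2_rho_vacL2 (p q : σ → ℝ) :
    ⟪(vacL2 : L2R σ), rho p q vacL2⟫_ℂ = cexp (-(π / 2 : ℂ) * ∑ k, ((p k : ℂ) ^ 2 + (q k : ℂ) ^ 2)) := by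
  rw [vacL2, inner_cohL2_left, ← vacL2, bargmannFun_rho, zero_add, bargmannFun_vacL2, mul_one, rhoPhase]
  congr 1
  rw [Finset.mul_sum]
  refine Finset.sum_congr rfl fun k _ => ?_
  simp only [Pi.zero_apply, zero_mul, mul_zero, sub_zero, phasePt, map_add, map_mul, Complex.conj_ofReal,
    Complex.conj_I]
  ring_nf
  rw [I_sq]
  ring

omit [DecidableEq σ] in
/-- The same coefficient on the other side: `⟪ρ(p,q) k₀, k₀⟫ = e^{-(π/2) Σ_k (p_k² + q_k²)}` (it is real).
[cite: Folland1989, (1.72)] -/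
theorem inner_rho_vacL2_vacL2 (p q : σ → ℝ) :
    ⟪rho p q (vacL2 : L2R σ), vacL2⟫_ℂ = cexp (-(π / 2 : ℂ) * ∑ k, ((p k : ℂ) ^ 2 + (q k : ℂ) ^ 2)) := by
  rw [← inner_conj_symm, inner_vacL2_rho_vacL2, ← Complex.exp_conj]
  congr 1
  rw [map_mul, map_neg, map_div₀, Complex.conj_ofReal, map_ofNat, map_sum]
  congr 1
  refine Finset.sum_congr rfl fun k _ => ?_
  rw [map_add, map_pow, map_pow, Complex.conj_ofReal, Complex.conj_ofReal]

/-- **The diagonal coefficient of the vacuum under the representation**: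
`⟪ρ((p,q),t) k₀, k₀⟫ = 𝐞(t) 𝐞(−½ p·q) e^{-(π/2) Σ_k (p_k² + q_k²)}`. [cite: Folland1989, (1.72), §1.5 Theorem (1.50)] -/
theorem inner_rhoRep_vacL2_vacL2 (p q : σ → ℝ) (t : ℝ) :
    ⟪rhoRep σ ⟨(p, q), t⟩ (vacL2 : L2R σ), vacL2⟫_ℂ =
      conj (((𝐞 (t - 2⁻¹ * (p ⬝ᵥ q))) : Circle) : ℂ) *
        cexp (-(π / 2 : ℂ) * ∑ k, ((p k : ℂ) ^ 2 + (q k : ℂ) ^ 2)) := by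
  rw [rhoRep_mk_apply, inner_smul_left, inner_rho_vacL2_vacL2]

end Literature.Analysis.SegalBargmann

end
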